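import Summits.ABC.FunctionField.TransferSheetMason
import Literature.Barriers.ABC.EpsilonCannotBeDroppedPolylog
import HarnessLib
import HarnessLib.Audit

/-!
# Cell abc-ff — transfer sheet: WINDOW GUARDS, part 2 (the hits-only Mason requirement
# `SmallDerivativesOnHitsWith η` at `η ≤ 0`, and its Mason-exact polylog form, refuted AS TYPED)

`Summits/ABC/FunctionField/TransferSheetWindowHits.lean` (cell abc-ff; kernel certificates by the cell's
referee B, abc-ff-ref-2, `HOME/ref-2/RefB_v02_tree.lean` §«hits-only Mason row», re-pointed to the tree
decl `Summit.ABC.FunctionField.SmallDerivativesOnHitsWith` of `TransferSheetMason.lean` and landed by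
the typer; part 1 is `TransferSheetWindow.lean`).
* `not_smallDerivativesOnHitsWith_of_nonpos` — the hits-only requirement is FALSE for `η ≤ 0`:
  `|ψ(p)| < c^η ≤ 1` forces `ψ = 0` (never independent), so every hit is exceptional, and the
  Stewart–Tijdeman pigeonhole (`Literature.Barriers.ABC.exists_abc_triple_polylog_loss`) supplies hits
  beyond every bound (the refuting triples ARE hits; compare `not_smallDerivativesWith_of_nonpos`).
* `SmallDerivativesOnHitsPolylog A` — the VERBATIM transcription of row MS-5 on hits
  (`‖ψ‖ ≤ (log c)^A`), typed FOR THE RECORD as a refuted strengthening, and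
  `not_smallDerivativesOnHitsPolylog` — false for every real `A` (Pasten Thm 3.3 `abc_estimate_holds`
  + the same hits): the `η > 0` is load-bearing in chain (c) exactly as the `ε` in chains (a)/(b).

Docstring update of record (referee B, REF-B v0.4 §3, superseding the «WHY IT MIGHT FAIL» sentence of
`SmallDerivativesOnHitsAllExponents` in `TransferSheetMason.lean`): that failure mode is now
INSTANTIATED — PATH: dead below `η = 1/2` modulo an `S`-unit-prime hypothesis `H_hit` (on the hits
`(2^α, 3^β, q^v · r)` every adapted independent `ψ` has `‖ψ‖ ≥ T* ≍ min(min(a,b), (c/(q^v L))^{1/2})`;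
14 balanced members with `c ∈ [10^40, 10^60]` certified at `log_c T* ∈ [0.432, 0.462]`, cell folder
`ref-2/compute/`); live window `[1/2, 1)` ⇒ POLY-abc(`M > 2`) at best; the quality-`> 1 + δ` restriction
is `⟺ ABC`. So the hits-only envelope is ALSO expected false below `1/2` (under `H_hit`), next to the
Schinzel sentence for the all-triples envelope (`TransferSheetMasonRigid.lean`).
HONESTY: abc is not proved by any of this; these are negative results about junk parameters.
-/

noncomputable section

open Literature.NumberTheory.DiophantineGeometry
open Literature.Barriers.ABC Literature.Barriers.ABC.Pasten

namespace Summit.ABC.FunctionField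

/-! ### The hits-only Mason row: `η ≤ 0` and the polylog form refuted as typed -/

/-- `W^0 = 0`: the zero derivation is never independent. [folklore] -/
theorem pasten_wronskian_zero (a b : ℕ) : wronskian (fun _ => 0) a b = 0 := by
  simp [wronskian, arithDerivWith]

/-- An excluded triple is never a hit (`c < rad`), so on hits `¬ IsExcludedTriple` is automatic.
[folklore] -/
theorem not_isExcludedTriple_of_hit {a b c : ℕ} (habc : IsABCTriple a b c) (hhit : rad a b c < c) :
    ¬ IsExcludedTriple a b c := fun hex => by
  have h11 : (a, b) ≠ (1, 1) := by
    intro h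
    simp only [Prod.mk.injEq] at h
    obtain ⟨rfl, rfl⟩ := h
    obtain ⟨-, -, hsum, -⟩ := habc
    subst hsum
    have h2 : 2 ≤ rad 1 1 (1 + 1) := by
      show 2 ≤ UniqueFactorizationMonoid.radical (1 * 1 * (1 + 1))
      exact Nat.two_le_radical_iff.mpr (by norm_num)
    omega
  have := lt_rad_of_isExcludedTriple habc hex h11
  omega

/-- **R1′ at `η ≤ 0` is refuted as typed**: `|ψ(p)| < c^η ≤ 1` forces `ψ = 0` (never
independent), so every hit is exceptional, and the Stewart–Tijdeman pigeonhole
(`exists_abc_triple_polylog_loss`) supplies hits beyond every bound. [cite: BombieriGubler2006, Prop. 12.4.12] -/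
theorem not_smallDerivativesOnHitsWith_of_nonpos {η : ℝ} (hη : η ≤ 0) : ¬ SmallDerivativesOnHitsWith η := by
  intro hfin
  rw [SmallDerivativesOnHitsWith] at hfin
  obtain ⟨C₀, hC₀⟩ : ∃ C₀ : ℕ, ∀ t ∈ {t : ℕ × ℕ × ℕ | IsABCTriple t.1 t.2.1 t.2.2 ∧
      ¬ IsExcludedTriple t.1 t.2.1 t.2.2 ∧ rad t.1 t.2.1 t.2.2 < t.2.2 ∧
      ¬ ∃ ψ : ℕ → ℤ, IsAdapted ψ t.1 t.2.1 ∧ wronskian ψ t.1 t.2.1 ≠ 0 ∧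
          ∀ p : ℕ, (|ψ p| : ℝ) < (t.2.2 : ℝ) ^ η}, t.2.2 ≤ C₀ :=
    ⟨hfin.toFinset.sup fun t => t.2.2, fun t ht =>
      Finset.le_sup (f := fun t : ℕ × ℕ × ℕ => t.2.2) (hfin.mem_toFinset.mpr ht)⟩
  obtain ⟨a, b, c, habc, hc, hradlt, -⟩ := exists_abc_triple_polylog_loss 0 1 (C₀ + 1)
  have hmem : (a, b, c) ∈ {t : ℕ × ℕ × ℕ | IsABCTriple t.1 t.2.1 t.2.2 ∧
      ¬ IsExcludedTriple t.1 t.2.1 t.2.2 ∧ rad t.1 t.2.1 t.2.2 < t.2.2 ∧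
      ¬ ∃ ψ : ℕ → ℤ, IsAdapted ψ t.1 t.2.1 ∧ wronskian ψ t.1 t.2.1 ≠ 0 ∧
          ∀ p : ℕ, (|ψ p| : ℝ) < (t.2.2 : ℝ) ^ η} := by
    refine ⟨habc, not_isExcludedTriple_of_hit habc hradlt, hradlt, ?_⟩
    rintro ⟨ψ, -, hW, hψ⟩
    have hc1 : (1 : ℝ) ≤ (c : ℝ) := by exact_mod_cast (by omega : 1 ≤ c)
    have hψ0 : ψ = fun _ => 0 := by
      funext p
      have h1 : (c : ℝ) ^ η ≤ 1 := Real.rpow_le_one_of_one_le_of_nonpos hc1 hη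
      have h2 : (|ψ p| : ℝ) < 1 := (hψ p).trans_le h1
      have h3 : |ψ p| < 1 := by exact_mod_cast h2
      exact Int.abs_lt_one_iff.mp h3
    subst hψ0
    exact hW (pasten_wronskian_zero _ _)
  have := hC₀ _ hmem
  dsimp only at this
  omega

/-- The exceptional set of the hits-only polylog statement with exponent `A`. [folklore] -/
def smallDerivativesOnHitsPolylogExceptions (A : ℝ) : Set (ℕ × ℕ × ℕ) :=
  {t : ℕ × ℕ × ℕ | IsABCTriple t.1 t.2.1 t.2.2 ∧ ¬ IsExcludedTriple t.1 t.2.1 t.2.2 ∧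
      rad t.1 t.2.1 t.2.2 < t.2.2 ∧
      ¬ ∃ ψ : ℕ → ℤ, IsAdapted ψ t.1 t.2.1 ∧ wronskian ψ t.1 t.2.1 ≠ 0 ∧
          ∀ p : ℕ, (|ψ p| : ℝ) ≤ Real.log (t.2.2 : ℝ) ^ A}

/-- **Hits-only «small derivatives, Mason-exact (polylog) form» with exponent `A`** — the VERBATIM
transcription of row MS-5 (`‖d/dX‖ = O(1)` ↦ `‖ψ‖ ≤ (log c)^A`): off a finite set, every abc-HIT admits
an adapted independent `ψ` with `‖ψ‖ ≤ (log c)^A`. Typed FOR THE RECORD as a refuted strengthening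
(`not_smallDerivativesOnHitsPolylog`: false for every real `A`); never to be posited. [folklore] -/
@[conjecture] def SmallDerivativesOnHitsPolylog (A : ℝ) : Prop :=
  (smallDerivativesOnHitsPolylogExceptions A).Finite

/-- **The hits-only polylog form is refuted as typed, for every real `A`** — same mechanism as
the all-triples refutation (Pasten Thm 3.3 `abc_estimate_holds` + `exists_abc_triple_polylog_loss`),
whose witness triple IS a hit. [cite: Pasten2021, Thm. 3.3] [cite: BombieriGubler2006, Prop. 12.4.12] -/
theorem not_smallDerivativesOnHitsPolylog (A : ℝ) : ¬ SmallDerivativesOnHitsPolylog A := by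
  intro hfin
  rw [SmallDerivativesOnHitsPolylog] at hfin
  obtain ⟨C₀, hC₀⟩ : ∃ C₀ : ℕ, ∀ t ∈ smallDerivativesOnHitsPolylogExceptions A, t.2.2 ≤ C₀ :=
    ⟨hfin.toFinset.sup fun t => t.2.2, fun t ht =>
      Finset.le_sup (f := fun t : ℕ × ℕ × ℕ => t.2.2) (hfin.mem_toFinset.mpr ht)⟩
  obtain ⟨a, b, c, habc, hc, hradlt, hlt⟩ :=
    exists_abc_triple_polylog_loss (⌈A⌉₊ + 1) (1 / Real.log 2) (max (C₀ + 1) 3)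
  have hcC₀ : C₀ < c := by have := le_max_left (C₀ + 1) 3; omega
  have hc3 : 3 ≤ c := (le_max_right _ _).trans hc
  have hnot : (a, b, c) ∉ smallDerivativesOnHitsPolylogExceptions A := fun h => by
    have := hC₀ _ h; dsimp only at this; omega
  have h11 : (a, b) ≠ (1, 1) := by
    intro h
    simp only [Prod.mk.injEq] at h
    obtain ⟨rfl, rfl⟩ := h
    have := habc.2.2.1
    omega
  have hnex : ¬ IsExcludedTriple a b c := not_isExcludedTriple_of_hit habc hradlt
  have hψ : ∃ ψ : ℕ → ℤ, IsAdapted ψ a b ∧ wronskian ψ a b ≠ 0 ∧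
      ∀ p : ℕ, (|ψ p| : ℝ) ≤ Real.log (c : ℝ) ^ A := by
    by_contra hno
    exact hnot ⟨habc, hnex, hradlt, hno⟩
  obtain ⟨ψ, had, hW, hψ⟩ := hψ
  obtain ⟨ha, hb, hsum, hcop⟩ := habc
  subst hsum
  have hest := abc_estimate_holds a b ψ (Real.log ((a + b : ℕ) : ℝ) ^ A) ⟨ha, hb, rfl, hcop⟩ h11
    had hW hψ
  set cR : ℝ := ((a + b : ℕ) : ℝ) with hcR
  set L : ℝ := Real.log cR with hL
  set R : ℝ := (rad a b (a + b) : ℝ) with hR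
  have hc3R : (3 : ℝ) ≤ cR := by rw [hcR]; exact_mod_cast hc3
  have hcpos : 0 < cR := by linarith
  have h13 : (1 : ℝ) < Real.log 3 := by
    rw [Real.lt_log_iff_exp_lt (by norm_num)]
    have := Real.exp_one_lt_d9
    linarith
  have hL1 : 1 < L := h13.trans_le (Real.log_le_log (by norm_num) hc3R)
  have hLpos : 0 < L := by linarith
  have hR0 : 0 ≤ R := Nat.cast_nonneg _
  have hlog2 : 0 < Real.log 2 := Real.log_pos (by norm_num)
  have h1 : cR ≤ R * L ^ A * L / Real.log 2 := by
    have := (div_le_iff₀ hLpos).mp hest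
    calc cR ≤ R * L ^ A / Real.log 2 * L := this
      _ = R * L ^ A * L / Real.log 2 := by ring
  have h2 : L ^ A ≤ L ^ (⌈A⌉₊ : ℕ) := by
    rw [← Real.rpow_natCast]
    exact Real.rpow_le_rpow_of_exponent_le hL1.le (Nat.le_ceil A)
  have h3 : cR ≤ 1 / Real.log 2 * R * L ^ (⌈A⌉₊ + 1) := by
    calc cR ≤ R * L ^ A * L / Real.log 2 := h1
      _ ≤ R * L ^ (⌈A⌉₊ : ℕ) * L / Real.log 2 := by gcongr
      _ = 1 / Real.log 2 * R * L ^ (⌈A⌉₊ + 1) := by rw [pow_succ]; ring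
  exact absurd hlt (not_lt.mpr h3)

end Summit.ABC.FunctionField

end
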